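import Mathlib
import HarnessLib.Audit
import Summits.PneNP.PneNP.Theorems.PstarNorUnitFinal

/-!
# The regime partition of a terminal core: (U2) / (EXC) / single (EQ) chord / at most five outputs (ROUND-24, memo §9 R-chain, end of the NOR branch)

FRONTIER range-avoidance ladder, rung F-N3, ROUND 24 (cell `pnp-ideate`, planner memo `r24/CORE-BOUND-NOTES.md` §9 R1–R9, §13 (P1)/(P3); restricted-model
proof complexity — nothing here bears on `P` versus `NP`).

`PstarChordBridgeBasis.regime_cases` (pnp-ideate-prover-2) puts a terminal core in the (U2) corner or in the direction picture with every chord (EQ), (EXC)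
or (NOR) w.r.t. `q_m`.  This file finishes the bookkeeping: `regime_partition` — under the hypotheses of `regime_cases` plus `J₀` XOR-closed with
`#J₀ < r`, `#(J₀ ∪ G₁ ∪ G₂) ≤ r`, pendants off the core and `J₀ ∖ N` peelable, EXACTLY ONE of four things happens:

* (U2)  `N = {e₀}` read by both constraints independently — and then `J₀ = D e₀ + e₀` is a single cycle (`subset_cycle_of_single`);
* (EXC) in the read direction some chord is an elliptic bundle `Q_{D e} = q_m + ν₁ν₂ + κ`;
* (EQ1) in the read direction `N = {e₀}` is a single (EQ) chord `Q_{D e₀} = q_m + κ` — again `J₀ = D e₀ + e₀` (several (EQ) chords are impossible by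
  `PstarChordBridgeForcing.chord_eq_of_EQ`; an (EQ) chord next to a (NOR) chord by `PstarNorUnitDirAssembly.not_EQ_of_nor_dir`);
* (SMALL) `#J₀ ≤ 5` (all chords (NOR): `PstarNorUnitFinal.card_le_five_of_regime_nor`).

`subset_cycle_of_single`: one chord `e₀ ∈ J₀`, `J₀ − e₀` peelable, `D ⊆ J₀ − e₀` with `D + e₀` everywhere even, `J₀` leafless ⟹ `J₀ ⊆ D + e₀` (even-or-cut:
an even family through `t` passes through `D`; a cut crossed by `t` alone has `D + e₀` on one side — the part on the other side is an even subset of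
the forest — and then `PstarNorUnitCover.false_of_side`).
-/

set_option linter.dupNamespace false -- `Summit.PneNP.PneNP.…`: summit = sub-problem name (D-0017 single-conjunct layout)

open Finset Literature.Computability.Complexity
open Summit.PneNP.PneNP.Theorems.PstarTyped (Typed)
open Summit.PneNP.PneNP.Theorems.PstarSALevel (BoundaryExpanding SimpleOverlap)
open Summit.PneNP.PneNP.Theorems.PstarCoreBound (XorClosed)
open Summit.PneNP.PneNP.Theorems.PstarCubeIdeals (IsAffineFn)
open Summit.PneNP.PneNP.Theorems.PstarProductRank (qform)
open Summit.PneNP.PneNP.Theorems.PstarXorElimination (pdeg)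
open Summit.PneNP.PneNP.Theorems.PstarXCore (xpair xverts mem_xpair)
open Summit.PneNP.PneNP.Theorems.PstarReadSumset (V2)
open Summit.PneNP.PneNP.Theorems.PstarChordBridgeTools (xpdeg privs)
open Summit.PneNP.PneNP.Theorems.PstarChordBridge (BridgeData sys Solution Lift)
open Summit.PneNP.PneNP.Theorems.PstarChordBridgeForcing (gam chord_eq_of_EQ)
open Summit.PneNP.PneNP.Theorems.PstarChordBridgeCotree (Peelable)
open Summit.PneNP.PneNP.Theorems.PstarChordBridgeBasis (qDir polarDir regime_cases)
open Summit.PneNP.PneNP.Theorems.PstarNorUnitDirAssembly (not_EQ_of_nor_dir)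
open Summit.PneNP.PneNP.Theorems.PstarNorUnitCoverTools (two_le_xpdeg_of_xorClosed exists_even_or_cut exists_mem_fundamental_of_even)
open Summit.PneNP.PneNP.Theorems.PstarNorUnitCover (false_of_side)
open Summit.PneNP.PneNP.Theorems.PstarNorUnitFinal (card_le_five_of_regime_nor)

namespace Summit.PneNP.PneNP.Theorems.PstarNorUnitRegime

variable {n m : ℕ}

/-! ## One chord: the core is one cycle -/

/-- **A leafless core with a single chord is the fundamental cycle of that chord.**  `e₀ ∈ J₀`, `J₀ − e₀` peelable, `D ⊆ J₀ − e₀` with `D + e₀`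
everywhere even, `J₀` leafless ⟹ `J₀ ⊆ D + e₀`. -/
theorem subset_cycle_of_single (I : LocalMap 4 n m) (hI : I.IsPure xorAndPred) {J₀ D : Finset (Fin m)} {e₀ : Fin m} (he₀ : e₀ ∈ J₀)
    (hP : Peelable I (J₀.erase e₀)) (hD : D ⊆ J₀.erase e₀) (hDeven : ∀ w, Even (xpdeg I (insert e₀ D) w))
    (hL₀ : ∀ w ∈ xverts I J₀, 2 ≤ xpdeg I J₀ w) : J₀ ⊆ insert e₀ D := by
  classical
  intro t ht
  by_contra htJ'
  have hte : t ≠ e₀ := fun h => htJ' (h ▸ mem_insert_self _ _)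
  rcases exists_even_or_cut I J₀ ht with ⟨Z, hZ, htZ, hZeven⟩ | ⟨x, hx⟩
  · obtain ⟨e, -, htD⟩ := exists_mem_fundamental_of_even I (N := {e₀}) (D := fun _ => D)
      (by rw [sdiff_singleton_eq_erase]; exact hP) (fun e _ => by rw [sdiff_singleton_eq_erase]; exact hD)
      (fun e he => by rw [mem_singleton.1 he]; exact hDeven) hZ hZeven htZ (by rw [mem_singleton]; exact hte)
    exact htJ' (mem_insert_of_mem htD)
  · have h2 : ∀ a b : ZMod 2, a + b = 0 → a = b := by decide
    have hx' : ∀ j ∈ J₀, j ≠ t → x (I.vars j 0) = x (I.vars j 1) := fun j hj hjt => h2 _ _ (by rw [hx j hj, if_neg hjt])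
    have hJ'sub : insert e₀ D ⊆ J₀ := by
      intro j hj
      rcases mem_insert.1 hj with rfl | hj
      · exact he₀
      · exact mem_of_mem_erase (hD hj)
    -- every output of `D + e₀` carries the label of `e₀`
    set c : ZMod 2 := x (I.vars e₀ 0) with hc
    have hlab : ∀ j ∈ insert e₀ D, x (I.vars j 0) = c := by
      by_contra hno
      push Not at hno
      obtain ⟨j₁, hj₁, hj₁c⟩ := hno
      set E : Finset (Fin m) := (insert e₀ D).filter fun j => x (I.vars j 0) ≠ c with hE
      have hEsub : E ⊆ J₀.erase e₀ := by
        intro j hj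
        obtain ⟨hj, hjc⟩ := mem_filter.1 hj
        rcases mem_insert.1 hj with rfl | hj
        · exact absurd hc.symm hjc
        · exact hD hj
      have hEeven : ∀ w, Even (xpdeg I E w) := by
        intro w
        by_cases hw : x w = c
        · -- no output of `E` touches `w`
          have h0 : xpdeg I E w = 0 := by
            unfold xpdeg pdeg
            rw [Nat.add_eq_zero_iff, card_eq_zero, card_eq_zero]
            refine ⟨filter_eq_empty_iff.2 fun j hj h => ?_, filter_eq_empty_iff.2 fun j hj h => ?_⟩
            · obtain ⟨-, hjc⟩ := mem_filter.1 hj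
              have h' : I.vars j 0 = w := h
              exact hjc (by rw [h']; exact hw)
            · obtain ⟨hj', hjc⟩ := mem_filter.1 hj
              have hjt : j ≠ t := fun h' => htJ' (h' ▸ hj')
              have h' : I.vars j 1 = w := h
              exact hjc ((hx' j (hJ'sub hj') hjt).trans (by rw [h']; exact hw))
          rw [h0]
          exact ⟨0, rfl⟩
        · -- every output of `D + e₀` at `w` lies in `E`
          have hfull : xpdeg I E w = xpdeg I (insert e₀ D) w := by
            unfold xpdeg pdeg
            congr 1
            · congr 1
              ext j
              simp only [hE, mem_filter]
              constructor
              · rintro ⟨⟨hj, -⟩, h⟩; exact ⟨hj, h⟩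
              · rintro ⟨hj, h⟩; exact ⟨⟨hj, h.symm ▸ hw⟩, h⟩
            · congr 1
              ext j
              simp only [hE, mem_filter]
              constructor
              · rintro ⟨⟨hj, -⟩, h⟩; exact ⟨hj, h⟩
              · rintro ⟨hj, h⟩
                have hjt : j ≠ t := fun h' => htJ' (h' ▸ hj)
                exact ⟨⟨hj, (hx' j (hJ'sub hj) hjt).trans_ne (h.symm ▸ hw)⟩, h⟩
          rw [hfull]
          exact hDeven w
      obtain ⟨w, hw⟩ := hP E hEsub ⟨j₁, mem_filter.2 ⟨hj₁, hj₁c⟩⟩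
      have := hEeven w
      rw [hw] at this
      exact absurd this (by decide)
    -- `t` crosses: one end off the label `c`
    have hPJ : Peelable I (J₀ \ insert e₀ D) :=
      hP.subset fun j hj => mem_erase.2 ⟨fun h => (mem_sdiff.1 hj).2 (h ▸ mem_insert_self _ _), (mem_sdiff.1 hj).1⟩
    have ht' : t ∈ J₀ \ insert e₀ D := mem_sdiff.2 ⟨ht, htJ'⟩
    have ht1 : x (I.vars t 0) + x (I.vars t 1) = 1 := by rw [hx t ht, if_pos rfl]
    by_cases hu : x (I.vars t 0) = c
    · have hv : x (I.vars t 1) ≠ c := by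
        have : ∀ a b c : ZMod 2, a + b = 1 → a = c → b ≠ c := by decide
        exact this _ _ _ ht1 hu
      exact false_of_side I hI hL₀ hPJ ht' hx' (x (I.vars t 1)) (fun j hj => by rw [hlab j hj]; exact hv.symm)
        ((mem_xpair I).2 (Or.inr rfl)) rfl ((mem_xpair I).2 (Or.inl rfl)) (by rw [hu]; exact hv.symm)
    · exact false_of_side I hI hL₀ hPJ ht' hx' (x (I.vars t 0)) (fun j hj => by rw [hlab j hj]; exact fun h => hu h.symm)
        ((mem_xpair I).2 (Or.inl rfl)) rfl ((mem_xpair I).2 (Or.inr rfl)) (by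
          have : ∀ a b c : ZMod 2, a + b = 1 → a ≠ c → b = c := by decide
          rw [this _ _ _ ht1 hu]; exact fun h => hu h.symm)

/-- The single-chord case for bridge data: `N = {e₀}` ⟹ `J₀ = D e₀ + e₀`. -/
theorem J₀_eq_of_single (I : LocalMap 4 n m) (hI : I.IsPure xorAndPred) (hT : Typed I) {B : BridgeData n m} (hW : B.WF I)
    (hX : XorClosed I B.J₀) (hP : Peelable I (B.J₀ \ B.N)) {e₀ : Fin m} (hN : B.N = {e₀}) : B.J₀ = insert e₀ (B.D e₀) := by
  classical
  have he₀ : e₀ ∈ B.N := by rw [hN]; exact mem_singleton_self _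
  refine Subset.antisymm ?_ fun j hj => ?_
  · refine subset_cycle_of_single I hI (hW.hN he₀) ?_ (fun j hj => ?_) (hW.hDeven e₀ he₀) (two_le_xpdeg_of_xorClosed I hT hX)
    · rw [← sdiff_singleton_eq_erase, ← hN]; exact hP
    · rw [← sdiff_singleton_eq_erase, ← hN]; exact hW.hD e₀ he₀ hj
  · rcases mem_insert.1 hj with rfl | hj
    · exact hW.hN he₀
    · exact (mem_sdiff.1 (hW.hD e₀ he₀ hj)).1

/-! ## The partition -/

/-- **Regime partition of a terminal core.**  See the module docstring. -/
theorem regime_partition (I : LocalMap 4 n m) (hI : I.IsPure xorAndPred) (hT : Typed I) (hS : SimpleOverlap I) {r : ℕ}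
    (hB : BoundaryExpanding r I) {B : BridgeData n m} (hW : B.WF I) (hJr : B.J₀.card < r) (hr : (B.J₀ ∪ B.G₁ ∪ B.G₂).card ≤ r)
    (hX : XorClosed I B.J₀) (hP : Peelable I (B.J₀ \ B.N)) (hG₁ : Disjoint B.G₁ B.J₀) (hG₂ : Disjoint B.G₂ B.J₀) (hN : B.N.Nonempty)
    (hL : Lift I B)
    (hun : ∀ v ∈ privs I B.N, (∀ g ∈ B.G₁, I.vars g 2 ≠ v ∧ I.vars g 3 ≠ v) ∧ ∀ g ∈ B.G₂, I.vars g 2 ≠ v ∧ I.vars g 3 ≠ v)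
    (hK : ∀ e ∈ B.N, ∀ e' ∈ B.N, e ≠ e' → ∃ a, (sys I B).u e a = 0 ∧ (sys I B).u e' a = 0)
    (hT3 : ¬ ∃ z, Solution I B B.J₀ z) (hM0 : ∀ e ∈ B.N, ∃ z, Solution I B (B.J₀.erase e) z) :
    (∃ e₀, B.N = {e₀} ∧ B.J₀ = insert e₀ (B.D e₀) ∧
      (sys I B).ρ e₀ 0 ≠ 0 ∧ (sys I B).ρ' e₀ 0 ≠ 0 ∧ (sys I B).ρ e₀ 0 ≠ (sys I B).ρ' e₀ 0) ∨
    (∃ mv : V2, mv ≠ 0 ∧ (∀ e ∈ B.N, ((sys I B).ρ e 0 = 0 ∨ (sys I B).ρ e 0 = mv) ∧ ((sys I B).ρ' e 0 = 0 ∨ (sys I B).ρ' e 0 = mv)) ∧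
      ∃ e ∈ B.N, ∃ ν₁ ν₂ : (Fin n → ZMod 2) → ZMod 2, IsAffineFn ν₁ ∧ IsAffineFn ν₂ ∧ ∃ κ : ZMod 2, ∀ x,
        qform (B.D e) (fun j => I.vars j 2) (fun j => I.vars j 3) x = qDir I B mv x + ν₁ x * ν₂ x + κ) ∨
    (∃ mv : V2, mv ≠ 0 ∧ (∀ e ∈ B.N, ((sys I B).ρ e 0 = 0 ∨ (sys I B).ρ e 0 = mv) ∧ ((sys I B).ρ' e 0 = 0 ∨ (sys I B).ρ' e 0 = mv)) ∧
      ∃ e₀, B.N = {e₀} ∧ B.J₀ = insert e₀ (B.D e₀) ∧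
        ∃ κ : ZMod 2, ∀ x, qform (B.D e₀) (fun j => I.vars j 2) (fun j => I.vars j 3) x = qDir I B mv x + κ) ∨
    B.J₀.card ≤ 5 := by
  classical
  rcases regime_cases I hI hT hS hB hW hJr.le hL hun hK hT3 hM0 with ⟨e₀, hNe, h1, h2, h3⟩ | ⟨mv, hmv, hreads, hall⟩
  · exact Or.inl ⟨e₀, hNe, J₀_eq_of_single I hI hT hW hX hP hNe, h1, h2, h3⟩
  right
  by_cases hEXC : ∃ e ∈ B.N, ∃ ν₁ ν₂ : (Fin n → ZMod 2) → ZMod 2, IsAffineFn ν₁ ∧ IsAffineFn ν₂ ∧ ∃ κ : ZMod 2, ∀ x,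
      qform (B.D e) (fun j => I.vars j 2) (fun j => I.vars j 3) x = qDir I B mv x + ν₁ x * ν₂ x + κ
  · exact Or.inl ⟨mv, hmv, hreads, hEXC⟩
  right
  by_cases hNOR : ∃ e ∈ B.N, ∃ a b : Fin n → ZMod 2, polarDir I B mv a b = 1 ∧
      (∀ x, qDir I B mv x =
        (polarDir I B mv x b + (qDir I B mv b + qDir I B mv 0)) * (polarDir I B mv x a + (qDir I B mv a + qDir I B mv 0)) + 1) ∧
      ∃ m₁ m₂ : (Fin n → ZMod 2) → ZMod 2, IsAffineFn m₁ ∧ IsAffineFn m₂ ∧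
        ∀ x, qform (B.D e) (fun j => I.vars j 2) (fun j => I.vars j 3) x + (gam B e + 1) =
          (polarDir I B mv x b + (qDir I B mv b + qDir I B mv 0) + 1) * m₁ x +
          (polarDir I B mv x a + (qDir I B mv a + qDir I B mv 0) + 1) * m₂ x
  · -- one (NOR) chord ⟹ no (EQ) chord ⟹ all chords (NOR)
    obtain ⟨e₁, he₁, a₁, b₁, -, hq₁, -⟩ := hNOR
    refine Or.inr (card_le_five_of_regime_nor I hI hT hS hB hW hr hJr hX hP hG₁ hG₂ hN mv fun e he => ?_)
    rcases hall e he with ⟨κ, hκ⟩ | h | h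
    · exact absurd (not_EQ_of_nor_dir I hI hS hB hW hJr.le mv hq₁ he hκ) id
    · exact absurd ⟨e, he, h⟩ hEXC
    · exact h
  · -- all chords (EQ) ⟹ a single chord
    have hEQ : ∀ e ∈ B.N, ∃ κ : ZMod 2, ∀ x, qform (B.D e) (fun j => I.vars j 2) (fun j => I.vars j 3) x = qDir I B mv x + κ := by
      intro e he
      rcases hall e he with h | h | h
      · exact h
      · exact absurd ⟨e, he, h⟩ hEXC
      · exact absurd ⟨e, he, h⟩ hNOR
    obtain ⟨e₁, he₁⟩ := hN
    obtain ⟨κ₁, hκ₁⟩ := hEQ e₁ he₁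
    have hNe : B.N = {e₁} := by
      refine eq_singleton_iff_unique_mem.2 ⟨he₁, fun e he => ?_⟩
      obtain ⟨κ, hκ⟩ := hEQ e he
      exact chord_eq_of_EQ I hI hS hW he he₁ hκ hκ₁
    exact Or.inl ⟨mv, hmv, hreads, e₁, hNe, J₀_eq_of_single I hI hT hW hX hP hNe, κ₁, hκ₁⟩

end Summit.PneNP.PneNP.Theorems.PstarNorUnitRegime
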